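import Summits.SmoothPoincare4.SmoothPoincare4.Theorems.CylinderEntropySliceIsolationStubCertMidLow3S1c
import Summits.SmoothPoincare4.SmoothPoincare4.Theorems.CylinderEntropySliceIsolationStubCertMidLow3S2b
import Summits.SmoothPoincare4.SmoothPoincare4.Theorems.CylinderEntropySliceIsolationStubCertMidLow3S3b
import Summits.SmoothPoincare4.SmoothPoincare4.Theorems.CylinderEntropySliceIsolationStubCertMidLow3S4c
import Mathlib
import HarnessLib

/-!
# Three-atom mid-low-scale certificate for the conformal kernel domination (stub `stub_certMidLow3`)

Helper file for the line `conformal-kernel-domination` of the crux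
`Summit.SmoothPoincare4.SmoothPoincare4.Theses.CylinderEntropy.SliceIsolation` (crux item
stmt-SmoothPoincare4-7632), part of the proof of the registered stub `stub_certMidLow3`
(three-atom certificates for the conformal kernel domination on `10⁻³ ≤ T ≤ 10⁻²`).
Notation and mechanism: see `CylinderEntropySliceIsolationStubCertMidLow3Base.lean`
(`pulled = (8π²/3)(4πT)⁻² e^{4u} e^{−Q/4T}`, `Q = (eᵘ−1)² + 2eᵘ(1−s)`; three broadened on-axis
cylinder ("zonal") atoms `wⱼ 𝔥(kⱼT, s) e^{−(u−σⱼ)²/(4kⱼT)}` with `σⱼ, log wⱼ` affine in `T, 1/T`, plus the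
area atom `c = 1/50`; far region `Q > q₀` under `c`; near region cut into `r`-cells and `s`-boxes, each
box closed by the softmax blending rule `certMidLow3_rule` with frozen weights `λ ∈ (1/16)ℤ⁴` and a
polynomial inequality certified by `linarith` from products of the box constraints).

This file only assembles the four sub-range certificates by a case split on `T`.
-/

noncomputable section

-- the registered namespace `Summit.SmoothPoincare4.SmoothPoincare4.Theorems…` repeats a component
set_option linter.dupNamespace false

namespace Summit.SmoothPoincare4.SmoothPoincare4.Theorems.CylinderEntropySliceIsolation

open Literature.Geometry.Riemannian Literature.Geometry.Riemannian.SphericalCylinderEntropy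

/-- **Three-atom mid-low-scale certificate** (`10⁻³ ≤ T ≤ 10⁻²`): at every such normalised scale
three broadened on-axis cylinder kernels plus an area atom of total mass `≤ 147/100` dominate the
Jacobian-weighted pulled-back Euclidean Gaussian kernel times `V = 8π²/3` on `ℝ × [−1, 1]`; assembled
from the four sub-range certificates `helper_certMidLow3Sub1…4` (`[10⁻³, 2·10⁻³]`, `[2·10⁻³, 4·10⁻³]`,
`[4·10⁻³, 7·10⁻³]`, `[7·10⁻³, 10⁻²]`).  Registered stub `stub_certMidLow3` of the line
`conformal-kernel-domination`. [folklore] -/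
theorem stub_certMidLow3 :
    ∀ T : ℝ, 1 / 1000 ≤ T → T ≤ 1 / 100 → ∃ σ₁ τ₁ w₁ σ₂ τ₂ w₂ σ₃ τ₃ w₃ c : ℝ, 0 < τ₁ ∧ 0 < τ₂ ∧ 0 < τ₃ ∧ 0 ≤ w₁ ∧ 0 ≤ w₂ ∧ 0 ≤ w₃ ∧ 0 ≤ c ∧
      w₁ + w₂ + w₃ + c ≤ 147 / 100 ∧
      ∀ u s : ℝ, -1 ≤ s → s ≤ 1 →
        (8 * Real.pi ^ 2 / 3) * ((4 * Real.pi * T) ^ 2)⁻¹ * Real.exp (4 * u) *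
            Real.exp (-(Real.exp (2 * u) - 2 * Real.exp u * s + 1) / (4 * T)) ≤
          w₁ * (zonal τ₁ s * Real.exp (-(u - σ₁) ^ 2 / (4 * τ₁))) + w₂ * (zonal τ₂ s * Real.exp (-(u - σ₂) ^ 2 / (4 * τ₂))) +
            w₃ * (zonal τ₃ s * Real.exp (-(u - σ₃) ^ 2 / (4 * τ₃))) + c := by
  intro T hT1 hT2
  rcases le_or_gt T (1 / 500) with h1 | h1
  · exact helper_certMidLow3Sub1 T hT1 h1
  rcases le_or_gt T (1 / 250) with h2 | h2
  · exact helper_certMidLow3Sub2 T h1.le h2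
  rcases le_or_gt T (7 / 1000) with h3 | h3
  · exact helper_certMidLow3Sub3 T h2.le h3
  exact helper_certMidLow3Sub4 T h3.le hT2

end Summit.SmoothPoincare4.SmoothPoincare4.Theorems.CylinderEntropySliceIsolation

end
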